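import Summits.BirchSwinnertonDyer.BirchSwinnertonDyer.Theses.ManinLocalTwoThree
import Summits.BirchSwinnertonDyer.BirchSwinnertonDyer.Theorems.TwistFamilyManinDescentEisensteinResidualOfTrichotomy
import Summits.BirchSwinnertonDyer.BirchSwinnertonDyer.Theorems.ManinLocalTwoThreeManinPrimeToAdditiveFiveLeCornersOfStrongIsUnstarred
import Literature.NumberTheory.GaloisRepresentations.PowerResidueCharacterCount
import HarnessLib

/-!
# Route `ManinLocalTwoThree`, residual crux C5 `ManinPrimeToAdditiveFiveLe` (stmt-BirchSwinnertonDyer-22969), line `upper_anchor`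
# (skeleton v14): **NO OVER-CLAIM on the new `13`-stub — C1 `EisensteinOrdinaryTwistLatticeNotBottom` (stmt-25939), and on the ordinary
# corner the leaves K18b″ (stmt-27662) and K18a″ (stmt-27661), are IMPLIED BY the crux**: C5 ⟹ C1, C5 ⟹ K18b″, C5 ⟹ K18a″ (kernel certificates)

Lead seat bsd-line-ml23-c5-p1 (gen 7). Skeleton v13/v14 re-socketed the `13`-locus onto route `TwistFamilyManinDescent`'s C1 ∧ C2 and the
ordinary corner unfolds (glue stmt-27664) into I9 ∧ K18a″ ∧ K18b″. Which of these leaves are SPECIAL CASES of C5 and which carry independent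
(orientation) content? The lead's gen-6 certificate p632301 did this for K15b (27071) and stmt-27552. THIS FILE adds, by ONE lattice lemma:

* `dvd_c_of_bottom` — **BOTTOM forces `p ∣ c`**: for `W/ℚ` globally minimal, additive and potentially good at `p ≥ 5` of UNSTARRED type
  (`ord_p Δ_min < 6`), with a datum `D` at the conductor level carrying the lattice clause (`Λ_W = c·Λ(f)`), the BOTTOM configuration
  `g(χ)·Λ(f ⊗ χ) ⊆ p·Λ(f)` of the Legendre twist forces `p ∣ c(D)`. Proof on pub/bsd-wall's twist frame (`EisensteinTrichotomy.exists_twist_frame`: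
  `V = C • (W ⊗ p*)` globally minimal with `ord_p u(C) = 0`, `W₀` the optimal curve of `V`'s class with lattice-optimal datum `D₀` and
  `f_{D₀} = f ⊗ χ`): the rational number `q = c·u/(p·c₀)` maps `Λ_{W₀}` into `Λ_V` (`y = c₀ w′ ↦ (c u/p)·w′`, and `g·(c/p)·w′ = c·y₁ ∈ Λ_W` by BOTTOM
  and the lattice clause), so `q ∈ ℤ` (`integral_neronScaling_of_isGloballyMinimal_holds`, Néron scalings between globally minimal models) and
  `ord_p c ≥ 1 + ord_p c₀ ≥ 1`. (This is the kernel form of route `TwistFamilyManinDescent`'s remark «i = p² (BOTTOM) forces c(W) = ±p·c(W^χ)».)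
* `eq_quadraticChar_ringHomComp_of_isQuadratic_of_ne_one` — a non-trivial quadratic Dirichlet character of prime level is the
  Legendre character (so the items' «every primitive quadratic `χ mod p`» is the Legendre twist).
* `eisensteinOrdinaryTwistLatticeNotBottom_of_maninPrimeToAdditiveFiveLe` — **Mazur → AU → Č → modularity → C5 → C1 (stmt-25939)**.
* `ordinaryCornerDeepUnstarredNotBottom_of_maninPrimeToAdditiveFiveLe` — **… → C5 → K18b″ (stmt-27662)**.
* `ordinaryCornerDeepEdixhovenDichotomy_of_maninPrimeToAdditiveFiveLe` — **… → C5 → K18a″ (stmt-27661)** (vacuously: its hypothesis `p ∣ c`).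
CONSEQUENCE for the planners: of the seven leaves of C5 (`Theorems/…LedgerSevenLeaves.lean`), FOUR are special cases of C5 (K15b, K18a″, K18b″,
C1 — with 27552 and 27071 by p632301), and exactly THREE carry content NOT implied by C5: the orientation laws K15a (27072), I9 (27660), C2 (26929).
HONEST STATUS: implications only (`--supports`, helper); nothing here proves C5, any leaf, Manin's conjecture or BSD.

References: [Stevens1989] Lemmas (5.2), (5.4); [EdixhovenManin1991] §4; [IrelandRosen1990] Ch. 8 §1 Prop. 8.1.4; [SilvermanAEC2009] VII.1.
-/

set_option autoImplicit false
-- the Theorems namespace of this sub repeats the summit name by design (D-0017 nested layout)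
set_option linter.dupNamespace false

noncomputable section

open scoped Classical NumberField

namespace Summit.BirchSwinnertonDyer.BirchSwinnertonDyer.Theorems

open WeierstrassCurve IsDedekindDomain Rat.HeightOneSpectrum NumberField
  Literature.NumberTheory.EllipticCurves Literature.NumberTheory.EllipticCurves.ModularForms
  Literature.NumberTheory.EllipticCurves.Rank1Residual
  Summit.BirchSwinnertonDyer.Rank1Residual Summit.BirchSwinnertonDyer.Rank1Residual.Additive
  Summit.BirchSwinnertonDyer.Rank1Residual.ManinAdditive
  Summit.BirchSwinnertonDyer.BirchSwinnertonDyer.Theorems.TeichmullerTwistDescentStarInvolution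
  Summit.BirchSwinnertonDyer.BirchSwinnertonDyer.Theorems.TwistFamilyManinDescent.EisensteinTrichotomy
  Summit.BirchSwinnertonDyer.BirchSwinnertonDyer.Theses.TwistFamilyManinDescent

/-! ## §0 Uniqueness of the quadratic character of prime level -/

/-- **A non-trivial quadratic Dirichlet character of prime level `p` is the Legendre character `(·/p) ⊗ ℂ`**: both take the value `1` exactly on
the squares of `(ℤ/p)ˣ` (Ireland–Rosen Prop. 8.1.4: `χ(a) = 1 ⟺ a` is an `(ord χ)`-th power, `ord χ = 2`) and `−1` elsewhere.
[cite: IrelandRosen1990, Ch. 8 §1 Prop. 8.1.4] -/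
theorem eq_quadraticChar_ringHomComp_of_isQuadratic_of_ne_one {p : ℕ} [Fact p.Prime]
    (χ : DirichletCharacter ℂ p) (hχ : χ.IsQuadratic) (h1 : χ ≠ 1) :
    χ = (quadraticChar (ZMod p)).ringHomComp (Int.castRingHom ℂ) := by
  haveI : Fact (Nat.Prime 2) := ⟨Nat.prime_two⟩
  have ho : orderOf χ = 2 := orderOf_eq_prime hχ.sq_eq_one h1
  apply MulChar.ext
  intro a
  have ha : (a : ZMod p) ≠ 0 := a.ne_zero
  rw [MulChar.ringHomComp_apply]
  by_cases hsq : IsSquare (a : ZMod p)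
  · have h1' : χ a = 1 := by
      rw [Literature.NumberTheory.GaloisRepresentations.FiniteField.mulChar_eq_one_iff_exists_pow_eq χ ha, ho]
      obtain ⟨x, hx⟩ := hsq
      exact ⟨x, by rw [hx, sq]⟩
    rw [h1', (quadraticChar_one_iff_isSquare ha).mpr hsq]
    simp
  · have hne : χ a ≠ 1 := by
      intro h1a
      rw [Literature.NumberTheory.GaloisRepresentations.FiniteField.mulChar_eq_one_iff_exists_pow_eq χ ha, ho] at h1a
      obtain ⟨x, hx⟩ := h1a
      exact hsq ⟨x, by rw [← hx, sq]⟩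
    have hm1 : χ a = -1 := by
      rcases hχ a with h | h | h
      · exfalso
        have hu : IsUnit (χ a) := a.isUnit.map χ
        rw [h] at hu
        exact not_isUnit_zero hu
      · exact absurd h hne
      · exact h
    rw [hm1, quadraticChar_neg_one_iff_not_isSquare.mpr hsq]
    simp


/-! ## §1 BOTTOM forces `p ∣ c` -/

/-- **The BOTTOM configuration of the Legendre twist forces `p ∣ c`.** `W/ℚ` globally minimal, additive at `p ≥ 5` with `0 ≤ ord_p j` and
`ord_p Δ_min < 6` (unstarred), `D` ANY datum at the conductor level (only `c·Λ(f_D) ⊆ Λ_W` is used); if `g(χ)·Λ(f_D ⊗ χ) ⊆ p·Λ(f_D)` for the Legendre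
character `χ`, then `p ∣ c(D)`. Twist frame + integrality of Néron scalings (module docstring). [cite: Stevens1989, Lemmas (5.2), (5.4)]
[cite: SilvermanAEC2009, VII.1 Prop. 1.3] -/
theorem dvd_c_of_bottom (hnf : exists_isNewformOf) (W : WeierstrassCurve ℚ) [W.IsElliptic] [W.IsGloballyMinimal]
    (p : ℕ) [hpF : Fact p.Prime] [NeZero (W.conductorNorm ℤ)] (D : ModularParametrizationData W (W.conductorNorm ℤ))
    (hsq : p ^ 2 ∣ W.conductorNorm ℤ) (hp5 : 5 ≤ p) (hadd : Rank1Residual.Addv W p) (hj : 0 ≤ padicValRat p W.j)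
    (hW6 : padicValInt p W.minimalDiscriminantInt < 6)
    (hbot : ∀ w ∈ periodLattice (charTwist (W.conductorNorm ℤ) (dvd_refl _) hsq
        (isQuadratic_quadraticChar_ringHomComp p) D.f),
      ∃ y ∈ periodLattice D.f,
        gaussSum ((quadraticChar (ZMod p)).ringHomComp (Int.castRingHom ℂ)) (ZMod.stdAddChar (N := p)) * w = (p : ℂ) * y) :
    (p : ℤ) ∣ D.c := by
  have hpP : p.Prime := hpF.out
  have hp2 : p ≠ 2 := by omega
  set G : ℂ := gaussSum ((quadraticChar (ZMod p)).ringHomComp (Int.castRingHom ℂ)) (ZMod.stdAddChar (N := p)) with hGdef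
  have hG0 : G ≠ 0 := gaussSum_stdAddChar_ne_zero_of_isPrimitive (isPrimitive_quadraticChar_ringHomComp p hp2)
  -- the twist frame
  obtain ⟨V, W₀, hVe, hVm, hE₀, hM₀, C, LV, D₀, hC, hu, -, -, -, hLV, -, -, hopt₀, hfeq⟩ :=
    exists_twist_frame hnf W p D hsq hp5 hadd hj hW6 (isQuadratic_quadraticChar_ringHomComp p)
  haveI := hVe
  haveI := hVm
  haveI := hE₀
  haveI := hM₀
  have htw : ∀ x : ℂ, x ∈ LV.lattice ↔ G * ((((C.u : ℚ) : ℂ))⁻¹ * x) ∈ D.L.lattice := fun x ↦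
    mem_lattice_twist_pStar_iff p hp2 W V D.isNeronLattice hLV C hC x
  -- constants and the rational multiplier `q = c u / (p c₀)`
  have hc : D.c ≠ 0 := D.maninConstant_ne_zero_holds
  have hc₀0 : D₀.c ≠ 0 := D₀.maninConstant_ne_zero_holds
  have hu0 : (C.u : ℚ) ≠ 0 := C.u.ne_zero
  have hp0 : (p : ℚ) ≠ 0 := by exact_mod_cast hpP.ne_zero
  have hcℂ : (D.c : ℂ) ≠ 0 := by exact_mod_cast hc
  have hc₀ℂ : (D₀.c : ℂ) ≠ 0 := by exact_mod_cast hc₀0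
  have huℂ : (((C.u : ℚ) : ℚ) : ℂ) ≠ 0 := by exact_mod_cast hu0
  have hpℂ : (p : ℂ) ≠ 0 := by exact_mod_cast hpP.ne_zero
  set q : ℚ := (D.c : ℚ) * (C.u : ℚ) / ((p : ℚ) * (D₀.c : ℚ)) with hqdef
  have hq0 : q ≠ 0 := div_ne_zero (mul_ne_zero (by exact_mod_cast hc) hu0) (mul_ne_zero hp0 (by exact_mod_cast hc₀0))
  have hqℂ : ((q : ℚ) : ℂ) = (D.c : ℂ) * (((C.u : ℚ) : ℚ) : ℂ) / ((p : ℂ) * (D₀.c : ℂ)) := by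
    rw [hqdef]; push_cast; ring
  -- BOTTOM: `qΛ_{W₀} ⊆ Λ_V`
  have hcl : ∀ y ∈ D₀.L.lattice, ((q : ℚ) : ℂ) * y ∈ LV.lattice := by
    intro y hy
    obtain ⟨w', hw', rfl⟩ := hopt₀ y hy
    rw [← hfeq] at hw'
    obtain ⟨y₁, hy₁, hGw⟩ := hbot w' hw'
    have h1 : (D.c : ℂ) * y₁ ∈ D.L.lattice := D.smul_periodLattice_le _ hy₁
    rw [htw, hqℂ]
    have e : G * ((((C.u : ℚ) : ℚ) : ℂ)⁻¹ * ((D.c : ℂ) * (((C.u : ℚ) : ℚ) : ℂ) / ((p : ℂ) * (D₀.c : ℂ)) * ((D₀.c : ℂ) * w'))) =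
        (D.c : ℂ) / (p : ℂ) * (G * w') := by
      field_simp
    rw [e, hGw]
    convert h1 using 1
    field_simp
  obtain ⟨k, hk⟩ := integral_neronScaling_of_isGloballyMinimal_holds W₀ V D₀.L LV D₀.isNeronLattice hLV q hcl
  -- valuations: `0 ≤ ord_p q = ord_p c + ord_p u − 1 − ord_p c₀`
  have hvq : 0 ≤ padicValRat p q := by
    rw [← hk, padicValRat.of_int]
    exact_mod_cast Nat.zero_le _
  have e : padicValRat p q = padicValRat p (D.c : ℚ) + padicValRat p (C.u : ℚ) -
      (padicValRat p (p : ℚ) + padicValRat p (D₀.c : ℚ)) := by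
    rw [hqdef, padicValRat.div (mul_ne_zero (by exact_mod_cast hc) hu0) (mul_ne_zero hp0 (by exact_mod_cast hc₀0)),
      padicValRat.mul (by exact_mod_cast hc) hu0, padicValRat.mul hp0 (by exact_mod_cast hc₀0)]
  have hpv : padicValRat p (p : ℚ) = 1 := by exact_mod_cast padicValRat.self hpP.one_lt
  rw [hu, hpv, padicValRat.of_int, padicValRat.of_int] at e
  have hc₀v : (0 : ℤ) ≤ padicValInt p D₀.c := by exact_mod_cast Nat.zero_le _
  have h1 : (1 : ℤ) ≤ padicValInt p D.c := by
    have := hvq; rw [e] at this; linarith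
  have h1' : 1 ≤ padicValInt p D.c := by exact_mod_cast h1
  exact (padicValInt_dvd_iff 1 D.c).mpr (Or.inr (by simpa using h1')) |> fun h ↦ by simpa using h

/-! ## §2 The certificates: C5 ⟹ C1, C5 ⟹ K18b″, C5 ⟹ K18a″ -/

/-- **C1 `EisensteinOrdinaryTwistLatticeNotBottom` (stmt-BirchSwinnertonDyer-25939) is a SPECIAL CASE of C5** (granted C5's own four displayed
antecedents, which C1 does not display): the `13`-stub `stub_notBottom13` of skeleton v13/v14 carries no content beyond the crux. A primitive
quadratic `χ mod p` is the Legendre character (§0); BOTTOM would give `p ∣ c` (§1), C5 gives `p ∤ c`.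
[cite: Stevens1989, Lemmas (5.2), (5.4)] [cite: EdixhovenManin1991, §4] -/
theorem eisensteinOrdinaryTwistLatticeNotBottom_of_maninPrimeToAdditiveFiveLe
    (hM : mazur_not_dvd_maninConstant_of_odd) (hAU : abbesUllmo_not_dvd_maninConstant_of_not_dvd_level)
    (hC : cesnavicius_not_two_dvd_maninConstant_of_two_dvd_level) (hnf : exists_isNewformOf)
    (h5 : Summit.BirchSwinnertonDyer.BirchSwinnertonDyer.Theses.ManinLocalTwoThree.ManinPrimeToAdditiveFiveLe) :
    EisensteinOrdinaryTwistLatticeNotBottom := by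
  intro W _ _ p _ _ D hsq h11 hadd _hred hGo hv4 hopt χ hχ hprim hbot
  have hpP : p.Prime := Fact.out
  have hp1 : χ ≠ 1 := by
    intro h
    have hcond := (DirichletCharacter.isPrimitive_def χ).mp hprim
    rw [h, DirichletCharacter.conductor_one] at hcond
    exact hpP.one_lt.ne hcond
  obtain rfl := eq_quadraticChar_ringHomComp_of_isQuadratic_of_ne_one χ hχ hp1
  have hj : 0 ≤ padicValRat p W.j := padicValRat_j_nonneg_of_typeGOrd W p hGo
  have hdvd := dvd_c_of_bottom hnf W p D hsq (by omega) hadd hj (by omega) hbot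
  exact h5 hM hAU hC hnf W D hopt p hpP (by omega) hsq hdvd

/-- **K18b″ `OrdinaryCornerDeepUnstarredNotBottom` (stmt-BirchSwinnertonDyer-27662) is a SPECIAL CASE of C5** (granted C5's four displayed
antecedents): on the unstarred ordinary corner rows `(5; 3)`, `(7; 2)`, `(7; 4)` BOTTOM would give `p ∣ c` (§1; `0 ≤ ord_p j` from «`W ⊗ p*`
additive»), C5 gives `p ∤ c`; the depth hypothesis is not used. [cite: Stevens1989, Lemmas (5.2), (5.4)] [cite: EdixhovenManin1991, §4] -/
theorem ordinaryCornerDeepUnstarredNotBottom_of_maninPrimeToAdditiveFiveLe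
    (hM : mazur_not_dvd_maninConstant_of_odd) (hAU : abbesUllmo_not_dvd_maninConstant_of_not_dvd_level)
    (hC : cesnavicius_not_two_dvd_maninConstant_of_two_dvd_level) (hnf : exists_isNewformOf)
    (h5 : Summit.BirchSwinnertonDyer.BirchSwinnertonDyer.Theses.ManinLocalTwoThree.ManinPrimeToAdditiveFiveLe) :
    OrdinaryCornerDeepUnstarredNotBottom := by
  intro W _ _ p _ _ D hsq hrow hred htw hopt _hdeep χ hχ hprim hbot
  have hpP : p.Prime := Fact.out
  have hp5 : 5 ≤ p := by
    rcases hrow with ⟨rfl, -⟩ | ⟨rfl, -⟩ <;> norm_num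
  have hp2 : p ≠ 2 := by omega
  have hW6 : padicValInt p W.minimalDiscriminantInt < 6 := by
    rcases hrow with ⟨rfl, h⟩ | ⟨rfl, h⟩
    · omega
    · simp only [Finset.mem_insert, Finset.mem_singleton] at h
      omega
  have hp1 : χ ≠ 1 := by
    intro h
    have hcond := (DirichletCharacter.isPrimitive_def χ).mp hprim
    rw [h, DirichletCharacter.conductor_one] at hcond
    exact hpP.one_lt.ne hcond
  obtain rfl := eq_quadraticChar_ringHomComp_of_isQuadratic_of_ne_one χ hχ hp1
  have hadd : Rank1Residual.Addv W p := not_good_and_not_mult_of_sq_dvd_conductorNorm W hsq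
  have hj : 0 ≤ padicValRat p W.j := padicValRat_j_nonneg_of_addv_of_twist_pStar_not_semistable W p hp2 hadd htw
  have hdvd := dvd_c_of_bottom hnf W p D hsq hp5 hadd hj hW6 hbot
  exact h5 hM hAU hC hnf W D hopt p hpP hp5 hsq hdvd

/-- **K18a″ `OrdinaryCornerDeepEdixhovenDichotomy` (stmt-BirchSwinnertonDyer-27661) is VACUOUSLY a special case of C5** (granted C5's four
displayed antecedents): its hypothesis `p ∣ c` contradicts C5. [cite: EdixhovenManin1991, §4] -/
theorem ordinaryCornerDeepEdixhovenDichotomy_of_maninPrimeToAdditiveFiveLe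
    (hM : mazur_not_dvd_maninConstant_of_odd) (hAU : abbesUllmo_not_dvd_maninConstant_of_not_dvd_level)
    (hC : cesnavicius_not_two_dvd_maninConstant_of_two_dvd_level) (hnf : exists_isNewformOf)
    (h5 : Summit.BirchSwinnertonDyer.BirchSwinnertonDyer.Theses.ManinLocalTwoThree.ManinPrimeToAdditiveFiveLe) :
    OrdinaryCornerDeepEdixhovenDichotomy := by
  intro W _ _ p _ _ D hsq hrow _hred _htw hopt _hdeep hdvd
  have hpP : p.Prime := Fact.out
  have hp5 : 5 ≤ p := by
    rcases hrow with ⟨rfl, -⟩ | ⟨rfl, -⟩ <;> norm_num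
  exact absurd hdvd (h5 hM hAU hC hnf W D hopt p hpP hp5 hsq)

end Summit.BirchSwinnertonDyer.BirchSwinnertonDyer.Theorems

end
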